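import Summits.AtomisticToContinuum.Crystallization.Theses.FreeSplittingCertificates

/-!
# `StrictSplittingRule` (stmt-AtomisticToContinuum-12560), line `birth` (registered): vocabulary and seam

Route `FreeSplittingCertificates`, crux r3 `StrictSplittingRule` (X₁ of the route: for every hard core `δ > 0`
a finite-range pair-splitting rule that is FEASIBLE on `δ`-separated configurations and STRICT toward the
stretched hcp shell `S(a,t)`).  This file fixes the VOCABULARY of the crux line `birth`
(crux workfile `Cruxes/StrictSplittingRule/Lines/birth.lean`, two-tolerance sandwich by convex mixing of
splitting rules) so that the line's three registered stubs
(`stub_hcpFamilyMinimiser`, `stub_coarseGapCertificate`, `stub_perturbativeCertificate`), landed as separate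
`--supports` files, speak about the same objects:

* `eInf` — Fekete's constant `e_∞ = ⨅_M E(M+1)/(M+1)`, the crux's threshold;
* `IsRule Φ` — box + complementarity of a pair-splitting rule; `Sep δ x` — `δ`-separation;
* `siteE R Φ x i` — the weighted site energy read at radius `R`; `shell a x k` — the recentred first shell
  (radius `5a/4`); `target a t` — the stretched hcp shell `S(a,t)`;
* `Feasible δ R Φ`, `Strict δ R Φ a t` — the two halves of the crux; `strictSplittingRule_iff` records that
  this vocabulary IS the crux's inlined text (`Iff.rfl`);
* `HcpFamilyMin a h` — rule-free pinning of the lattice parameters (global minimality of `hcp(a,h)` in the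
  two-parameter hcp family);
* the SEAM of the line: `mix` (convex combination of rules), `isRule_mix` (the rule class is convex) and
  `siteE_mix` (the weighted site energy is affine in the rule);
* (appended, reshape r2 of the perturbative stub S2b) `patternShell`, `GoodAt`, `compositeRule`,
  `bondPattern`, `goodSum` and the core hypothesis `PerturbativeCore δ a t η₀ e` with its registered
  anchor `stub_coreMono` (antitone in the threshold).

These are line-internal bookkeeping definitions (the crux's own inlined text, named) and two elementary
lemmas, plus the registered anchor stub `stub_defs` (`Φ ≡ 1/2` is a rule); nothing here closes an item and
nothing is assumed by any landed theorem.  The sorry-free composition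
`S0a → S0b → S1 → S2a → S2b → StrictSplittingRule` lives in the crux workfile and lands last.
-/

noncomputable section

namespace Summit.AtomisticToContinuum.Crystallization.Theorems.StrictSplittingRuleBirth

open scoped BigOperators Classical
open Literature.MathematicalPhysics.StatisticalMechanics
open Literature.Geometry.DiscreteGeometry

/-- Euclidean `3`-space. -/
local notation "E3" => EuclideanSpace ℝ (Fin 3)

/-! ## Vocabulary (definitionally the crux's inlined text, see `strictSplittingRule_iff`) -/

/-- Fekete's constant `e_∞ = ⨅_M E(M+1)/(M+1)` for Lennard-Jones in `ℝ³` (the crux's threshold;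
`= lim E(N)/N` by `BlancLewin2015_8_holds`). [folklore] -/
def eInf : ℝ := ⨅ M : ℕ, groundStateEnergy lennardJones 3 (M + 1) / ((M + 1 : ℕ) : ℝ)

/-- Box and complementarity constraints of a pair-splitting rule `Φ(v, pattern)`:
`0 ≤ Φ ≤ 1` and `Φ(v,T) + Φ(−v, T − v) = 1` for `v ≠ 0`. [folklore] -/
def IsRule (Φ : E3 → Finset E3 → ℝ) : Prop :=
  (∀ v T, 0 ≤ Φ v T ∧ Φ v T ≤ 1) ∧ (∀ v T, v ≠ 0 → Φ v T + Φ (-v) (T.image fun u => u - v) = 1)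

/-- `δ`-separation (hard core) of a finite configuration. [folklore] -/
def Sep (δ : ℝ) {N : ℕ} (x : Fin N → E3) : Prop := ∀ i j, i ≠ j → δ ≤ dist (x i) (x j)

/-- Weighted site energy of site `i` under the rule `Φ` read at radius `R`: the bond `(i,j)` carries the
weight `Φ (x_j − x_i) T_ij` with pattern `T_ij = {x_l − x_i : dist(x_l,x_i) ≤ R ∨ dist(x_l,x_j) ≤ R}`.
[folklore] -/
def siteE (R : ℝ) (Φ : E3 → Finset E3 → ℝ) {N : ℕ} (x : Fin N → E3) (i : Fin N) : ℝ :=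
  ∑ j ∈ Finset.univ.erase i, Φ (x j - x i) ((Finset.univ.filter fun l =>
    dist (x l) (x i) ≤ R ∨ dist (x l) (x j) ≤ R).image fun l => x l - x i) * lennardJones (dist (x i) (x j))

/-- The recentred first shell (radius `5a/4`) of site `k`. [folklore] -/
def shell (a : ℝ) {N : ℕ} (x : Fin N → E3) (k : Fin N) : Finset E3 :=
  (Finset.univ.filter fun j => j ≠ k ∧ dist (x j) (x k) ≤ 5 * a / 4).image fun j => x j - x k

/-- The stretched hcp shell `S(a,t) = a·(hcpKissingPattern stretched by 1+t along its hexagonal axis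
(1,1,1))`. [folklore] -/
def target (a t : ℝ) : Finset E3 :=
  hcpKissingPattern.image fun u => a • (u + (t * (u 0 + u 1 + u 2) / 3) • intVec ![1, 1, 1])

/-- Feasibility of the rule `Φ` (radius `R`) on `δ`-separated configurations: every weighted site energy
is `≥ e_∞`. [folklore] -/
def Feasible (δ R : ℝ) (Φ : E3 → Finset E3 → ℝ) : Prop :=
  ∀ (N : ℕ) (x : Fin N → E3), Sep δ x → ∀ i : Fin N, eInf ≤ siteE R Φ x i

/-- Strictness of the rule `Φ` (radius `R`) toward `S(a,t)` on `δ`-separated configurations: for every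
`η > 0` some `c > 0` makes "weighted site energy `< e_∞ + c`" force the first shell to be `η`-close to
`S(a,t)`. [folklore] -/
def Strict (δ R : ℝ) (Φ : E3 → Finset E3 → ℝ) (a t : ℝ) : Prop :=
  ∀ η : ℝ, 0 < η → ∃ c : ℝ, 0 < c ∧ ∀ (N : ℕ) (x : Fin N → E3), Sep δ x → ∀ k : Fin N,
    siteE R Φ x k < eInf + c → ShellCloseTo η (shell a x k) (target a t)

/-- The crux, packaged: this is `Iff.rfl` — the vocabulary above IS the crux's inlined text. -/
theorem strictSplittingRule_iff :
    Summit.AtomisticToContinuum.Crystallization.Theses.FreeSplittingCertificates.StrictSplittingRule ↔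
      ∀ δ : ℝ, 0 < δ → ∃ (R : ℝ) (Φ : E3 → Finset E3 → ℝ) (a t : ℝ), 0 < R ∧ 0 < a ∧ |t| ≤ 1 / 100 ∧
        IsRule Φ ∧ Feasible δ R Φ ∧ Strict δ R Φ a t :=
  Iff.rfl

/-- RULE-FREE PINNING of the lattice parameters: `hcp(a,h)` (in-layer spacing `a`, layer spacing `h`,
`hcpPeriodicConfiguration`) minimises the Lennard-Jones energy per particle over the whole two-parameter hcp
family `a', h' > 0`. [folklore] -/
def HcpFamilyMin (a h : ℝ) : Prop :=
  ∃ (ha : a ≠ 0) (hh : h ≠ 0), ∀ (a' h' : ℝ) (ha' : a' ≠ 0) (hh' : h' ≠ 0), 0 < a' → 0 < h' →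
    (hcpPeriodicConfiguration ha hh).energyPerParticle lennardJones ≤
      (hcpPeriodicConfiguration ha' hh').energyPerParticle lennardJones

/-! ## The seam: convex mixing of rules -/

/-- Convex combination `(1-l)·Φ₁ + l·Φ₂` of two rules. [folklore] -/
def mix (l : ℝ) (Φ₁ Φ₂ : E3 → Finset E3 → ℝ) : E3 → Finset E3 → ℝ :=
  fun v T => (1 - l) * Φ₁ v T + l * Φ₂ v T

/-- The rule class (box + complementarity) is convex. -/
theorem isRule_mix {l : ℝ} (hl0 : 0 ≤ l) (hl1 : l ≤ 1) {Φ₁ Φ₂ : E3 → Finset E3 → ℝ}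
    (h₁ : IsRule Φ₁) (h₂ : IsRule Φ₂) : IsRule (mix l Φ₁ Φ₂) := by
  refine ⟨fun v T => ?_, fun v T hv => ?_⟩
  · obtain ⟨h1a, h1b⟩ := h₁.1 v T
    obtain ⟨h2a, h2b⟩ := h₂.1 v T
    have hl1' : 0 ≤ 1 - l := sub_nonneg.mpr hl1
    refine ⟨?_, ?_⟩
    · show 0 ≤ (1 - l) * Φ₁ v T + l * Φ₂ v T
      nlinarith [mul_nonneg hl1' h1a, mul_nonneg hl0 h2a]
    · show (1 - l) * Φ₁ v T + l * Φ₂ v T ≤ 1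
      nlinarith [mul_le_mul_of_nonneg_left h1b hl1', mul_le_mul_of_nonneg_left h2b hl0]
  · have e₁ := h₁.2 v T hv
    have e₂ := h₂.2 v T hv
    show (1 - l) * Φ₁ v T + l * Φ₂ v T +
        ((1 - l) * Φ₁ (-v) (T.image fun u => u - v) + l * Φ₂ (-v) (T.image fun u => u - v)) = 1
    linear_combination (1 - l) * e₁ + l * e₂

/-- The weighted site energy is affine in the rule. -/
theorem siteE_mix (l R : ℝ) (Φ₁ Φ₂ : E3 → Finset E3 → ℝ) {N : ℕ} (x : Fin N → E3) (i : Fin N) :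
    siteE R (mix l Φ₁ Φ₂) x i = (1 - l) * siteE R Φ₁ x i + l * siteE R Φ₂ x i := by
  simp only [siteE, mix, Finset.mul_sum, ← Finset.sum_add_distrib]
  refine Finset.sum_congr rfl fun j _ => ?_
  ring

/-! ## Anchor -/

/-- Registered anchor sub-goal of the line (`stub_defs`): the constant rule `Φ ≡ 1/2` (every bond split
evenly) satisfies box + complementarity; its landing puts this vocabulary in the tree. -/
theorem stub_defs : IsRule (fun _ _ => (1 / 2 : ℝ)) := by
  refine ⟨fun _ _ => ⟨by norm_num, by norm_num⟩, fun _ _ _ => by norm_num⟩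

/-! ## Vocabulary of the perturbative half (reshape r2 of S2b: goodness read off a pattern, the
composite rule, the good-neighbour sum, and the CORE hypothesis `PerturbativeCore`) -/

/-- The recentred `5a/4`-shell of a pattern `T` around `w`: `{u − w : u ∈ T, u ≠ w, |u − w| ≤ 5a/4}`
(what a rule can read off the joint pattern about the first shell of either endpoint). [folklore] -/
def patternShell (a : ℝ) (T : Finset E3) (w : E3) : Finset E3 :=
  (T.filter fun u => u ≠ w ∧ dist u w ≤ 5 * a / 4).image fun u => u - w

/-- The endpoint `w` of a pattern `T` is GOOD at tolerance `η₀`: its `5a/4`-shell in `T` is `η₀`-close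
to `S(a,t)`. [folklore] -/
def GoodAt (a t η₀ : ℝ) (T : Finset E3) (w : E3) : Prop :=
  ShellCloseTo η₀ (patternShell a T w) (target a t)

/-- **The composite rule** over an inner rule `Φ₀`: both endpoints good or both bad (as read off the
joint pattern `T`) — use `Φ₀`; good–bad bond — the good end takes weight `0` if the bond is attractive
(`V_LJ(|v|) ≤ 0`) and `1` if repulsive, so bonds to bad sites never lower a good site's weighted
energy. [folklore] -/
def compositeRule (a t η₀ : ℝ) (Φ₀ : E3 → Finset E3 → ℝ) : E3 → Finset E3 → ℝ := fun v T =>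
  if GoodAt a t η₀ T 0 then
    (if GoodAt a t η₀ T v then Φ₀ v T else if lennardJones ‖v‖ ≤ 0 then 0 else 1)
  else
    (if GoodAt a t η₀ T v then (if lennardJones ‖v‖ ≤ 0 then 1 else 0) else Φ₀ v T)

/-- The realised joint `R`-pattern of the bond `(k,j)` seen from `x_k` — the argument `siteE` hands to
the rule (so `siteE R Φ x k = ∑_{j ≠ k} Φ (x j − x k) (bondPattern R x k j) · V_LJ(r_kj)` by `rfl`).
[folklore] -/
def bondPattern (R : ℝ) {N : ℕ} (x : Fin N → E3) (k j : Fin N) : Finset E3 :=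
  (Finset.univ.filter fun l => dist (x l) (x k) ≤ R ∨ dist (x l) (x j) ≤ R).image fun l => x l - x k

/-- The GOOD-NEIGHBOUR part of the weighted site energy of `k` under the inner rule `Φ₀`:
`∑_{j ≠ k, j good} Φ₀(x_j − x_k, T_kj) · V_LJ(r_kj)`. [folklore] -/
def goodSum (a t η₀ R : ℝ) (Φ₀ : E3 → Finset E3 → ℝ) {N : ℕ} (x : Fin N → E3) (k : Fin N) : ℝ :=
  ∑ j ∈ (Finset.univ.erase k).filter (fun j => ShellCloseTo η₀ (shell a x j) (target a t)),
    Φ₀ (x j - x k) (bondPattern R x k j) * lennardJones (dist (x k) (x j))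

/-- **`PerturbativeCore δ a t η₀ e`** — the analytic content of the perturbative half S2b, isolated
(reshape r2): for all radii `R ≥ R₀` some rule `Φ₀` makes, at every good site `k` of every
`δ`-separated configuration, the `Φ₀`-weighted energy of the bonds from `k` to its GOOD neighbours
`≥ e`, and `< e + c(η)` only if the shell of `k` is `η`-close to `S(a,t)`.  Intended threshold
`e = e(hcp(a,h))` at the family minimiser (then `e_∞ ≤ e` is `PeriodicUpperBound`): sitewise,
finite-range-redistributed first-and-second-order coercivity of the relaxed hcp crystal.  A line-internal
proof obligation (the registered stub `stub_perturbativeCore` asserts it), not a cited fact. [folklore] -/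
def PerturbativeCore (δ a t η₀ e : ℝ) : Prop :=
  ∃ R₀ : ℝ, ∀ R : ℝ, R₀ ≤ R → ∃ Φ₀ : E3 → Finset E3 → ℝ, IsRule Φ₀ ∧
    (∀ (N : ℕ) (x : Fin N → E3), Sep δ x → ∀ k : Fin N,
        ShellCloseTo η₀ (shell a x k) (target a t) → e ≤ goodSum a t η₀ R Φ₀ x k) ∧
    ∀ η : ℝ, 0 < η → ∃ c : ℝ, 0 < c ∧ ∀ (N : ℕ) (x : Fin N → E3), Sep δ x → ∀ k : Fin N,
      ShellCloseTo η₀ (shell a x k) (target a t) → goodSum a t η₀ R Φ₀ x k < e + c →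
        ShellCloseTo η (shell a x k) (target a t)

/-- Registered anchor `stub_coreMono` of reshape r2: the core hypothesis is ANTITONE in its threshold —
lowering `e` to `e' ≤ e` keeps it (same radius, same rule; the strictness premise `goodSum < e' + c`
implies `goodSum < e + c`).  Used with `e' = e_∞ ≤ e = e(hcp(a,h))`. -/
theorem stub_coreMono : ∀ δ a t η₀ e e' : ℝ, e' ≤ e →
    PerturbativeCore δ a t η₀ e → PerturbativeCore δ a t η₀ e' := by
  intro δ a t η₀ e e' hle ⟨R₀, hR₀⟩
  refine ⟨R₀, fun R hR => ?_⟩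
  obtain ⟨Φ₀, hrule, hge, hstrict⟩ := hR₀ R hR
  refine ⟨Φ₀, hrule, fun N x hx k hk => le_trans hle (hge N x hx k hk), fun η hη => ?_⟩
  obtain ⟨c, hc, hstr⟩ := hstrict η hη
  exact ⟨c, hc, fun N x hx k hk hlt => hstr N x hx k hk (lt_of_lt_of_le hlt (by linarith))⟩

end Summit.AtomisticToContinuum.Crystallization.Theorems.StrictSplittingRuleBirth

end
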